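import Literature.Geometry.Lorentzian.CauchyDevelopment
import Literature.Geometry.Lorentzian.ConvergenceTransport
import HarnessLib

/-!
# gr.S12, uniqueness of the MGHD, over the repaired development structure

`Literature.Geometry.Lorentzian.CauchyProblem` vendors the uniqueness clause of the
Choquet-Bruhat–Geroch theorem (Comm. Math. Phys. 14 (1969), Thm. 3, p. 332; Ringström 2009,
Thm. 16.6; Sbierski, Ann. Henri Poincaré 17 (2016), Thm. 2.6) as the named fact `mghd_unique`,
quantified over the structure `VacuumDevelopment D` of `Literature.Geometry.Lorentzian.Development`.
That structure is **uninhabited** (`Development.elim`, `DevelopmentProofs`: its Cauchy-surface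
field uses the misformalised `LorentzianMetric.IsCauchySurface`, `CausalityProofs`), so
`mghd_unique` holds *vacuously* (`mghd_unique_holds`, `CauchyProblemProofs`) and renders nothing of
the printed theorem. `Literature.Geometry.Lorentzian.CauchyDevelopment` carries the repair —
`DataEmbedding`, `CauchyDevelopment`, `VacuumCauchyDevelopment`, `VacuumCauchyDevelopment.IsMaximal`,
`DataEmbedding.IsIsometricTo` over the corrected notion `LorentzianMetric.IsCauchyHypersurface` —
and its porting guide assigns the re-vendoring of "the Choquet-Bruhat–Geroch facts of
`CauchyProblem`" over it. This file proves, over the repaired structure, everything of the printed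
uniqueness argument that the prelude can carry, and reduces the uniqueness clause to the one step
it cannot (D-0014: new names only; `mghd_unique` and the two existence facts
`choquetBruhat_geroch_exists_mghd`, `choquetBruhat_local_existence` are untouched):

* `PseudoRiemannianMetric.IsIsometricImmersion.comp`,
  `TimeOrientation.PreservesTimeOrientation.comp` — isometric immersions, and time-orientation
  preserving isometric immersions, compose (chain rule `pullbackBilin_comp`; the timecone lemma in
  the form `PreservesTimeOrientation.isFutureDirected_mfderiv` of `ConvergenceTransport`);
* `DataEmbedding.EmbedsInto.trans`, `CauchyDevelopment.EmbedsInto.trans` — embeddings of data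
  embeddings / Cauchy developments compose (Ringström 2009, Def. 16.5; the `Development` analogue
  `Development.embedsInto_trans` is a named fact, only vacuously discharged), **proved**;
* `DataEmbedding.isIsometricTo_of_embedsInto` — **two data embeddings which embed into each
  other are isometric as soon as the first is rigid** (every time-orientation preserving
  isometric immersion of it into itself fixing the data hypersurface pointwise is the identity):
  the composite self-embedding is then the identity, the reverse composite is the identity by
  injectivity, and the embedding is a time-orientation preserving isometric diffeomorphism
  commuting with the data embeddings, **proved** — this is the deduction "The uniqueness of M
  follows immediately from the uniqueness of (U, ψ)" of Choquet-Bruhat–Geroch (p. 334);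
* `VacuumCauchyDevelopment.isIsometricTo_of_isMaximal` — **any two maximal vacuum Cauchy
  developments of the same initial data set are isometric as developments, given rigidity of the
  first** (Choquet-Bruhat–Geroch 1969, Thm. 3; Ringström 2009, Thm. 16.6; Sbierski 2016,
  Thm. 2.6), **proved**: each embeds into the other by maximality, and
  `isIsometricTo_of_embedsInto` applies. Rigidity of data embeddings is the one step of the
  printed proof the prelude cannot yet carry (below); it enters as a hypothesis.

The corrected *named fact* itself — `mghd_unique` verbatim with `VacuumDevelopment ↦
VacuumCauchyDevelopment`, i.e. `∀ {D : InitialDataSet (𝓡 3) X} (𝒟₁ 𝒟₂ : VacuumCauchyDevelopment D),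
𝒟₁.IsMaximal → 𝒟₂.IsMaximal → 𝒟₁.toCauchyDevelopment.IsIsometricTo 𝒟₂.toCauchyDevelopment`
[cite: Ringstrom2009, Thm. 16.6] — is deliberately *not* declared here: under D-0026 a proving
seat may not add an unproved named fact, and its proof needs the rigidity step; by
`isIsometricTo_of_isMaximal` it is equivalent, over the prelude, to the rigidity of maximal vacuum
Cauchy developments.

## The printed argument and what the prelude lacks

Let `𝒟₁, 𝒟₂` be maximal: there are embeddings `ψ₁₂ : M₁ → M₂`, `ψ₂₁ : M₂ → M₁` (smooth,
time-orientation preserving, isometric open embeddings with `ψ₁₂ ∘ ι₁ = ι₂`, `ψ₂₁ ∘ ι₂ = ι₁`;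
Ringström 2009, Def. 16.5; Sbierski 2016, Def. 2.3). (1) `φ := ψ₂₁ ∘ ψ₁₂ : M₁ → M₁` is a
time-orientation preserving isometric immersion with `φ ∘ ι₁ = ι₁` (`EmbedsInto.trans`). (2) At
`p = ι₁ x`, `dφ_p` fixes the spacelike hyperplane `dι₁ (T_x X)` pointwise, hence preserves its
orthogonal line `ℝ ν₁ x` and, being a linear isometry preserving the future cone, fixes the future
unit normal: `dφ_p = id`. (3) A local isometry of a connected semi-Riemannian manifold is
determined by its value and differential at one point (O'Neill 1983, Ch. 3, Prop. 3.62: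
`φ ∘ exp_p = exp_p ∘ dφ_p`, then an open–closed argument); this is the step "ψ and ψ̃ coincide
wherever they are both defined" of Choquet-Bruhat–Geroch's proof of Thm. 3 (p. 332, through the
normal data `(q, η, λ)` of timelike geodesics issuing from `S`). Hence `φ = id` — the *rigidity*
of `𝒟₁` — and then (`isIsometricTo_of_embedsInto`) `ψ₁₂ ∘ ψ₂₁ = id` as well and `ψ₁₂` is a
time-orientation preserving isometric diffeomorphism with `ψ₁₂ ∘ ι₁ = ι₂`. Step (3) has no carrier
in the prelude yet (geodesics of the Koszul-defined `leviCivita` and their existence are themselves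
named facts; naturality of the connection under isometries and the exponential map are absent),
which is why rigidity enters `isIsometricTo_of_isMaximal` as a hypothesis.

## References

* Y. Choquet-Bruhat, R. Geroch, *Global aspects of the Cauchy problem in general relativity*,
  Comm. Math. Phys. 14 (1969) 329–335: Definition (extension) and Thm. 2, p. 331; Thm. 3 and its
  proof, p. 332 ("This development is unique (up to isometry)"); p. 334 ("The uniqueness of M
  follows immediately from the uniqueness of (U, ψ)").
* H. Ringström, *The Cauchy Problem in General Relativity*, EMS 2009, Def. 16.5, Thm. 16.6.
* J. Sbierski, *On the existence of a maximal Cauchy development for the Einstein equations: a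
  dezornification*, Ann. Henri Poincaré 17 (2016) 301–329 = arXiv:1309.7591: Def. 2.3, Thm. 2.6
  ("The GHD M̃ is unique up to isometry and is called the maximal globally hyperbolic
  development"), end of §3.
* B. O'Neill, *Semi-Riemannian geometry with applications to relativity*, Academic Press 1983,
  Ch. 3, p. 58 (pullbacks compose) and Prop. 3.62 (local isometries are determined by their
  1-jet at a point); Ch. 5, Lemma 5.29 and p. 145 (timecones).
-/

noncomputable section

open Function
open scoped Manifold ContDiff Topology

namespace Literature.Geometry.Lorentzian

universe u

/-! ### Composition of (time-orientation preserving) isometric immersions -/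

section Generic

variable {E : Type*} [NormedAddCommGroup E] [NormedSpace ℝ E] {H : Type*} [TopologicalSpace H]
  {I : ModelWithCorners ℝ E H} {n : ℕ∞ω} {M : Type*} [TopologicalSpace M] [ChartedSpace H M]
  [IsManifold I ∞ M]
  {E' : Type*} [NormedAddCommGroup E'] [NormedSpace ℝ E'] {H' : Type*} [TopologicalSpace H']
  {I' : ModelWithCorners ℝ E' H'} {N : Type*} [TopologicalSpace N] [ChartedSpace H' N]
  [IsManifold I' ∞ N]
  {E'' : Type*} [NormedAddCommGroup E''] [NormedSpace ℝ E''] {H'' : Type*} [TopologicalSpace H'']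
  {I'' : ModelWithCorners ℝ E'' H''} {P : Type*} [TopologicalSpace P] [ChartedSpace H'' P]
  [IsManifold I'' ∞ P]

namespace PseudoRiemannianMetric

variable {gN : PseudoRiemannianMetric I' ∞ E' (TangentSpace I' : N → Type _)}
  {gM : PseudoRiemannianMetric I ∞ E (TangentSpace I : M → Type _)}
  {gP : PseudoRiemannianMetric I'' ∞ E'' (TangentSpace I'' : P → Type _)}

/-- **Isometric immersions compose**: if `f^* g_M = g_N` and `g^* g_P = g_M` for smooth `f`, `g`,
then `(g ∘ f)^* g_P = f^* (g^* g_P) = g_N` (chain rule for pullbacks, `pullbackBilin_comp`).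
O'Neill 1983, Ch. 3, p. 58. [cite: ONeillSemiRiemannian1983, Ch. 3, p. 58] -/
theorem IsIsometricImmersion.comp {g : M → P} {f : N → M} (hg : IsIsometricImmersion gM gP g)
    (hf : IsIsometricImmersion gN gM f) : IsIsometricImmersion gN gP (g ∘ f) := by
  refine ⟨hg.1.comp hf.1, fun y ↦ ?_⟩
  rw [pullbackBilin_comp (hg.1.mdifferentiable (by simp)) (hf.1.mdifferentiable (by simp)),
    show pullbackBilin (I := I'') (I' := I) g gP.val = gM.val from funext hg.2]
  exact hf.2 y

end PseudoRiemannianMetric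

namespace TimeOrientation

variable {gN : LorentzianMetric I' n N} {gM : LorentzianMetric I n M} {gP : LorentzianMetric I'' n P}
  {τN : TimeOrientation gN} {τM : TimeOrientation gM} {τP : TimeOrientation gP}

/-- **Time-orientation preserving isometric immersions compose.** If `f : N → M` and `g : M → P`
preserve the time orientations and `g^* g_P = g_M`, then `d(g ∘ f) T_N = dg (df T_N)` is
future-directed: `df T_N` is future-directed causal and `dg` maps future-directed vectors to
future-directed ones (the timecone lemma, `PreservesTimeOrientation.isFutureDirected_mfderiv`;
O'Neill 1983, Ch. 5, Lemma 5.29 and p. 145). This is the time-orientation clause of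
Ringström 2009, Def. 16.5 (embeddings of developments form a preorder).
[cite: ONeillSemiRiemannian1983, Ch. 5, Lemma 5.29 and p. 145] -/
theorem PreservesTimeOrientation.comp {g : M → P} {f : N → M}
    (hg : τM.PreservesTimeOrientation g τP) (hf : τN.PreservesTimeOrientation f τM)
    (hgi : ∀ x, pullbackBilin (I := I'') (I' := I) g gP.val x = gM.val x)
    (hgd : MDifferentiable I I'' g) (hfd : MDifferentiable I' I f) :
    τN.PreservesTimeOrientation (g ∘ f) τP := by
  intro y
  rw [mfderiv_comp y (hgd (f y)) (hfd y)]
  exact hg.isFutureDirected_mfderiv hgi (hf y)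

end TimeOrientation

end Generic

/-! ### Embeddings of data embeddings compose; mutual embeddings of rigid data embeddings -/

section DataEmbedding

variable {n : ℕ} {X' : Type u} [TopologicalSpace X'] [ChartedSpace (EuclideanSpace ℝ (Fin n)) X']
  [IsManifold (𝓡 n) ∞ X'] [ConnectedSpace X'] {D : InitialDataSet (𝓡 n) X'}

namespace DataEmbedding

/-- **Embeddings of data embeddings compose**: the composite `ψ₂₃ ∘ ψ₁₂` of two embeddings is a
smooth isometric open embedding (`IsIsometricImmersion.comp`, `IsOpenEmbedding.comp`), preserves
time orientation (`PreservesTimeOrientation.comp`, i.e. the timecone lemma) and satisfies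
`(ψ₂₃ ∘ ψ₁₂) ∘ ι₁ = ψ₂₃ ∘ ι₂ = ι₃`. Ringström 2009, Def. 16.5 (embeddings of developments form a
preorder); Sbierski 2016, §2. (The analogue for the defective `Development` structure,
`Development.embedsInto_trans`, is a named fact; this is its proof over the repaired structure.)
[cite: Ringstrom2009, Def. 16.5] -/
theorem EmbedsInto.trans {𝒮₁ 𝒮₂ 𝒮₃ : DataEmbedding D} (h₁₂ : 𝒮₁.EmbedsInto 𝒮₂)
    (h₂₃ : 𝒮₂.EmbedsInto 𝒮₃) : 𝒮₁.EmbedsInto 𝒮₃ := by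
  obtain ⟨ψ, hψs, hψo, hψi, hψt, hψc⟩ := h₁₂
  obtain ⟨χ, hχs, hχo, hχi, hχt, hχc⟩ := h₂₃
  exact ⟨χ ∘ ψ, hχs.comp hψs, hχo.comp hψo, hχi.comp hψi,
    hχt.comp hψt hχi.2 (hχs.mdifferentiable (by simp)) (hψs.mdifferentiable (by simp)),
    by rw [comp_assoc, hψc, hχc]⟩

/-- **Mutual embeddings of data embeddings are isometries, given rigidity.** Suppose every
time-orientation preserving smooth isometric immersion `φ : M₁ → M₁` with `φ ∘ ι₁ = ι₁` is the
identity (*rigidity* of `𝒮₁`; Choquet-Bruhat–Geroch 1969, proof of Thm. 3, p. 332: "ψ and ψ̃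
coincide wherever they are both defined", via the normal data of timelike geodesics from `S` —
O'Neill 1983, Ch. 3, Prop. 3.62). If `𝒮₁` embeds into `𝒮₂` by `ψ` and `𝒮₂` into `𝒮₁` by `χ`, then
`χ ∘ ψ` is such a self-immersion (`EmbedsInto.trans`), so `χ ∘ ψ = id`; as `χ` is injective also
`ψ ∘ χ = id`; hence `ψ` is a diffeomorphism with inverse `χ`, an isometry, time-orientation
preserving, with `ψ ∘ ι₁ = ι₂`: `𝒮₁` and `𝒮₂` are isometric. This is "The uniqueness of M follows
immediately from the uniqueness of (U, ψ)" (Choquet-Bruhat–Geroch 1969, p. 334).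
[cite: ChoquetBruhatGeroch1969CMP, Thm. 3, proof (p. 332) and p. 334] -/
theorem isIsometricTo_of_embedsInto {𝒮₁ 𝒮₂ : DataEmbedding D}
    (hrig : ∀ φ : 𝒮₁.carrier → 𝒮₁.carrier,
      𝒮₁.metric.IsIsometricImmersion 𝒮₁.metric.toPseudoRiemannianMetric φ →
        𝒮₁.timeOrientation.PreservesTimeOrientation φ 𝒮₁.timeOrientation →
          φ ∘ 𝒮₁.embed = 𝒮₁.embed → φ = id)
    (h₁₂ : 𝒮₁.EmbedsInto 𝒮₂) (h₂₁ : 𝒮₂.EmbedsInto 𝒮₁) : 𝒮₁.IsIsometricTo 𝒮₂ := by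
  obtain ⟨ψ, hψs, -, hψi, hψt, hψc⟩ := h₁₂
  obtain ⟨χ, hχs, hχo, hχi, hχt, hχc⟩ := h₂₁
  -- the composite self-embedding of `𝒮₁` fixes the data, hence is the identity (rigidity)
  have hχψ : χ ∘ ψ = id :=
    hrig _ (hχi.comp hψi)
      (hχt.comp hψt hχi.2 (hχs.mdifferentiable (by simp)) (hψs.mdifferentiable (by simp)))
      (by rw [comp_assoc, hψc, hχc])
  -- the reverse composite is the identity because `χ` is injective
  have hψχ : ψ ∘ χ = id := by
    funext y
    apply hχo.injective
    simpa using congrFun hχψ (χ y)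
  let Φ : Diffeomorph (𝓡 (n + 1)) (𝓡 (n + 1)) 𝒮₁.carrier 𝒮₂.carrier ∞ :=
    { toFun := ψ
      invFun := χ
      left_inv := fun x ↦ congrFun hχψ x
      right_inv := fun y ↦ congrFun hψχ y
      contMDiff_toFun := hψs
      contMDiff_invFun := hχs }
  exact ⟨Φ, hψi.2, hψt, hψc⟩

end DataEmbedding

/-- Embeddings of Cauchy developments compose (`DataEmbedding.EmbedsInto.trans`). Ringström 2009,
Def. 16.5. [cite: Ringstrom2009, Def. 16.5] -/
theorem CauchyDevelopment.EmbedsInto.trans {𝒟₁ 𝒟₂ 𝒟₃ : CauchyDevelopment D}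
    (h₁₂ : 𝒟₁.EmbedsInto 𝒟₂) (h₂₃ : 𝒟₂.EmbedsInto 𝒟₃) : 𝒟₁.EmbedsInto 𝒟₃ :=
  DataEmbedding.EmbedsInto.trans h₁₂ h₂₃

/-! ### gr.S12, uniqueness clause, over `VacuumCauchyDevelopment` -/

/-- **Uniqueness of the MGHD, given rigidity** (Choquet-Bruhat–Geroch, Comm. Math. Phys. 14
(1969), Thm. 3, p. 332: "there exists a development M of S which is an extension of every other
development of S. This development is unique (up to isometry)", with the deduction of pp. 332–334;
Ringström 2009, Thm. 16.6; Sbierski 2016, Thm. 2.6 and end of §3: "it is straightforward to deduce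
from this maximality property that M̃ is, up to isometry, the only GHD with this property"). Let
`𝒟₁, 𝒟₂` be maximal vacuum Cauchy developments of the same initial data set `D` on a connected
`n`-manifold (`VacuumCauchyDevelopment.IsMaximal`: every vacuum Cauchy development of `D` embeds
into them by a smooth, time-orientation preserving, isometric open embedding commuting with the
embeddings of the data manifold), and suppose `𝒟₁` is rigid: every time-orientation preserving
smooth isometric immersion `φ : M₁ → M₁` with `φ ∘ ι₁ = ι₁` is the identity (O'Neill 1983, Ch. 3,
Prop. 3.62 with the normal argument of the module docstring — the step of the printed proof the
prelude cannot yet carry). Then `𝒟₁` and `𝒟₂` are isometric as developments: each embeds into the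
other by maximality, and `DataEmbedding.isIsometricTo_of_embedsInto` applies. Over the prelude this
reduces the corrected form of `CauchyProblem.mghd_unique` (module docstring) to rigidity.
[cite: ChoquetBruhatGeroch1969CMP, Thm. 3 (pp. 332–334)] -/
theorem VacuumCauchyDevelopment.isIsometricTo_of_isMaximal {𝒟₁ 𝒟₂ : VacuumCauchyDevelopment D}
    (hrig : ∀ φ : 𝒟₁.carrier → 𝒟₁.carrier,
      𝒟₁.metric.IsIsometricImmersion 𝒟₁.metric.toPseudoRiemannianMetric φ →
        𝒟₁.timeOrientation.PreservesTimeOrientation φ 𝒟₁.timeOrientation →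
          φ ∘ 𝒟₁.embed = 𝒟₁.embed → φ = id)
    (h₁ : 𝒟₁.IsMaximal) (h₂ : 𝒟₂.IsMaximal) :
    𝒟₁.toCauchyDevelopment.IsIsometricTo 𝒟₂.toCauchyDevelopment :=
  DataEmbedding.isIsometricTo_of_embedsInto hrig (h₂ 𝒟₁) (h₁ 𝒟₂)

end DataEmbedding


end Literature.Geometry.Lorentzian

end
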